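import Summits.QuantumFields.YangMills.Theorems.UnitScaleTiltHalvingHSupURhoWindowCB9
import Summits.QuantumFields.YangMills.Theorems.UnitScaleTiltHalvingHSupURhoWindowsRho3
import Summits.QuantumFields.YangMills.Theorems.UnitScaleTiltHalvingP1FlatCoreSupplierInduction
import Literature.MathematicalPhysics.QuantumFieldTheory.Balaban1983to89.B8LeafModelZd3
import Literature.MathematicalPhysics.QuantumFieldTheory.Balaban1983to89.B8Prop3GaugeFixedKLevel
import Literature.MathematicalPhysics.QuantumFieldTheory.Balaban1983to89.B8Prop6OfThm4
import Literature.MathematicalPhysics.QuantumFieldTheory.Balaban1983to89.T3PrintedRegularMinimiser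
import HarnessLib

/-!
# Route `UnitScaleTilt`, crux K1 child «MinimiserStabilityRegPr» (stmt-QuantumFields-19200), registered stub `stub_halvingStep` (v10 `BirthV10`) —
# ★★ THE (1.59) JUNCTION AT THE TOP LEVEL: `H59TL` ⟸ THE ∀-LEVEL PRINT-SHAPE SOCKET `SB9AllL` (lit ✓`B8LeafModelZd3.SockB9P3`) AT `U₀ := 1`

Cell `ym3-torus` (HUMAN RULING D-0037: YM₃ on T³ is ladder rung R3 — NOT d = 4, NOT a mass gap, NOT the Clay problem), width seat `ym-ust-19200-w7` gen 6
(row «BASE-LEAF», LEAD-H ★w5-19200 g6 H-NAMER WORD 10; SHAPE RULING «`SB9AllL`» = `∀ F n K (hnK) a ρ′, ∀ m ≤ K − n, ∃ len, SockB9P3 … m (cubeFam…) (cubeLamS…)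
(cubeLamB…)`; LOCATE-H59TL-TOP 039d0f5e (19200 evidence) + LEAD-H's LOCATE-159-MERGE #41).
`--supports stmt-QuantumFields-19200 --as helper`; THEOREMS ONLY (0 `def`, 0 `sorry`); count-neutral; nothing here claims `SB9AllL`, the stub, the crux or the gap.

WHAT.  ★★ `H59TL_of_sockB9All`: for one `L` and one set of socket constants `B₀ B₀'H B₂' BG BR cB9 B₀β β` (signs of the six displayed ones), the ∀-level
(1.59)-family socket `SB9AllL` (print's hypotheses (1.40)–(1.42a) ONLY: `U₀, WU₀ ∈ 𝔄_k`, Landau of `W`, the a-priori chart (1.41), support — NO gauge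
transformation `u`, NO (1.29), NO comb clause) IMPLIES BOARD v5's displayed `H59TL` (✓p673445 `hSupUρ4_of_sockets`' `hSockets₁`∕`hSockets₂` conjunct, text
VERBATIM): at every ρ4 member, for every `gJ` under J3's three rows and every admissible `(g′, u, V′, A′)`, lines 1–2 of (1.59) at the flat background.
MECHANISM (LOCATE-H59TL-TOP §4, by name): instantiate `SockB9P3` at `m := K − n`, `U₀ := 1`, `W := V′`, `α₀ := ε₀`, `α₂ := 2((F.P K).L·c⋆) + 8α₄`; the guard
`ε₀ ≤ cB9` is ✓p655819's (3)#1, the guard `0 < α₂ ≤ cB9` is ✓`HalvingHSupURhoWindowCB9.alpha2_le_cB9_of_hw` (this seat, file 1∕3) — both from the member's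
own smallness `hw` (factor `(1 + cB9⁻¹)`), after identifying the closure's letters `α₁ cstar α₄` with the bridge's by their displayed equations; `V′` unitary
⟸ `mgauge 1 u V′ = U′` (lit ✓`mem_unitaryUnits_of_mgauge_eq`); (1.40) for `U₀ = 1` = lit ✓`one_inAk`, for `V′·1` ⟸ J3's `InAk … univ U′` (✓`h34_of_inAk_univ`
+ lit ✓`mulCfg_eq_gaugeAct_of_mgauge_eq` + lit ✓`inAk_gaugeAct_iff`, the three lines of ✓`P1FlatCoreTopSizes.prop3_sizes_top`); Landau = `H59TL`'s own first
`Lan` conjunct; the idle guards (`Restr129 … (update … ∅)`, the comb clause, `InAx`, the tower row, the member datum) are introduced and dropped.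
WHY THIS IS HONEST (LOCATE-H59TL-TOP (b)(c)): [Balaban1985RegularSpaces] Prop. 3's hypotheses (1.40)–(1.42) p.83 contain no (1.29) at any level and no `u`;
(1.58)–(1.59) p.86 use Landau (1.42a) only, then [Balaban1985BackgroundPropagators] Thm 3.3 p.399 + (3.47) p.398 — whose hypotheses are on the
background alone ((3.35), void at `U₀ = 1`).  So `H59TL` is a WEAKENING of print's (1.59) and this junction merely discards its idle antecedents.
USE (BASE-LEAF wrapper, file 3∕3, and ★w3-19200 g9's step side): `H59TL_of_sockB9All M′ L hL hB₀ hB₀'H hB₂' hBG hBR hcB9 hSB9All` IS the `H59TL` conjunct.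
HONEST SCOPE: by-name instantiation; nothing of [4] Thm 3.3, Prop. 3, `SB9AllL`, `hSupUρ4`, the stub or the crux is proved or claimed here.

References: T. Bałaban, CMP **99** (1985) 75–102 [Balaban1985RegularSpaces] ((1.40)–(1.42) p.83, (1.55)–(1.59) p.86, Prop. 3 p.87, (1.29) p.81, Thm 4 p.88);
CMP **99** (1985) 389–434 [Balaban1985BackgroundPropagators] ((3.25)–(3.27) pp.394–395, Thm 3.1 p.397, (3.47) p.398, Thm 3.3 p.399).
-/

set_option autoImplicit false

noncomputable section

open scoped BigOperators Matrix.Norms.L2Operator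
open NormedSpace
open Complex (I)

namespace Summit.QuantumFields.YangMills.Theorems.HalvingH59TLOfSockB9All

open Literature.MathematicalPhysics.QuantumFieldTheory.Balaban1983to89
open Literature.MathematicalPhysics.QuantumFieldTheory.Balaban1983to89.T3ContinuumYM3Torus
open Literature.MathematicalPhysics.QuantumFieldTheory.Balaban1983to89.T3PrintedRegularMinimiser (RegPr regFibrePr)
open B5Eq118OneStroke (iterBlockOf)
open B7Prop1Explicit (e)
open B7Prop1Explicit renaming Site → LSite
open B7Prop2Explicit (unitaryUnits avgIter unitaryUnits_le_U1)
open B7Prop1Local (InBox loK bondHiK)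
open B7Eq92Concrete (mgauge)
open B8Ineq130 (tlo thi)
open B8Ineq132 (covDerivFwd InAk inAk_gaugeAct_iff)
open B8Eq119TwistedAxial (Restr129 InAx)
open B8Eq131Cubes (tLo tHi)
open B8Eq131CubesAdmissible (cubeFam)
open B8CubeMemberZd (cubeLamS cubeLamB)
open B8Lemma1NonAbelian (mulCfg)
open B8Eq184Proof (cfgExp)
open B8Eq140Level (SideTouches)
open B8Eq146AExpansion (iEta)
open B8Eq138LandauZd (IsLandau138W)
open B7Prop4GeneralLevels (linCovIter)
open B8Eq155JBound (Jcur wsup)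
open B8ScaledSupNorm (bondNorm msup)
open B8LeafModelZd3 (SockB9P3)
open B8Prop6OfThm4 (one_inAk)
open B8Prop3GaugeFixedKLevel (mulCfg_eq_gaugeAct_of_mgauge_eq mem_unitaryUnits_of_mgauge_eq)
open B10Eq27TorusAxialLog (pull pull_apply unitsField toUField gaugeActT unitsField_mem_unitaryUnits)
open B15Eq112TorusCover (cover)
open HalvingHSupURhoWindowsRho3 (exists_topCall_constants_of_rhoWindow₃)
open HalvingHSupURhoWindowCB9 (alpha2_le_cB9_of_hw)
open HalvingP1FlatCoreSupplierInduction (h34_of_inAk_univ)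

/-- ★★ **THE TOP-LEVEL (1.59) JUNCTION**: `H59TL` (BOARD v5's displayed conjunct, text VERBATIM) from the ∀-level print-shape socket `SB9AllL` at
`m := K − n`, `U₀ := 1`, `W := V′`, `α₀ := ε₀`, `α₂ := 2((F.P K).L·c⋆) + 8α₄` — the guards `u`∕`Restr129(∅)`∕comb∕`InAx`∕tower are idle and dropped.
[cite: Balaban1985RegularSpaces, (1.40)-(1.42) p.83, (1.58)-(1.59) p.86, Prop. 3 p.87; Balaban1985BackgroundPropagators, Thm 3.3 p.399, (3.47) p.398] -/
theorem H59TL_of_sockB9All (M' : ℕ) (L : ℕ) (hL : 1 < L)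
    {B₀ B₀'H B₂' BG BR cB9 B₀β β : ℝ} (hB₀ : 0 < B₀) (hB₀'H : 0 < B₀'H) (hB₂' : 0 ≤ B₂') (hBG : 0 ≤ BG) (hBR : 0 ≤ BR) (hcB9 : 0 < cB9)
    -- `SB9AllL`: the ∀-level (1.59)-family socket in print's shape (LEAD-H SHAPE RULING, WORD 10), at the member's cube-family geometry
    (hSB9All : ∀ (F : T3Family) (n K : ℕ), n < K → ∀ (a : LSite (F.P K).d) (ρ' : ℕ) (m : ℕ), m ≤ K - n → ∃ len : LSite (F.P K).d → ℝ,
      @SockB9P3 (F.P K).d (Matrix (Fin 2) (Fin 2) ℂ) (B10Eq29TubeLine.cstarAlgebraMatrix 2) (F.P K).L B₀ B₀β cB9 β len (((F.L : ℝ)⁻¹) ^ (K - n)) m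
        (cubeFam false (F.P K).L a M' ρ' (K - n)) (cubeLamS (F.P K).L a M' ρ' (K - n)) (cubeLamB (F.P K).L a M' ρ' (K - n))) :
    -- `H59TL` — ✓p673445 `hSupUρ4_of_sockets`' displayed conjunct, VERBATIM
    (∀ (F : T3Family), F.L = L → ∀ (n K : ℕ) (hnK : n < K) (ρ S M ρ' : ℕ), ρ' = ρ + M + L + S → 1 ≤ M → 2 ≤ S →
      ∀ (a₅ Cr ε₀ ε₁ : ℝ), 0 < Cr → 4 < Cr → 12 * ((ρ : ℝ) + (M : ℝ)) * a₅ ≤ Cr → 0 < ε₁ → 0 < ε₀ → ε₀ ≤ a₅ → Cr * ε₁ ≤ ε₀ →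
      (10 : ℝ) ^ 29 * (L : ℝ) ^ 12 * (1 + B₀ + B₀⁻¹) ^ 2 * ((1 + B₀'H) * (1 + B₂') * (1 + BG) * (1 + BR)) ^ 5 * (1 + cB9⁻¹) *
      ((((ρ + M + L + S : ℕ) : ℝ) + (M' : ℝ) + 1) ^ 3 * ε₀) ≤ 1 →
      2 * ρ + (M' + 1 + 2 * (M + L + S)) ≤ F.L ^ (F.m + n) →
      ∀ (V : GaugeField (F.P n) 0 (Matrix.specialUnitaryGroup (Fin 2) ℂ)), PlaqSmall ε₁ V → ∀ U ∈ regFibrePr F n K hnK.le ε₀ V,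
      ∀ (x₀ : Site (F.P K) 0) (t : ℤ), 0 ≤ t → t ≤ (M' : ℤ) - 1 →
      ∀ (a : LSite (F.P K).d), a = (fun μ => ((iterBlockOf (K - n) x₀ μ).val : ℤ) - t) →
      ∀ (α₁ α₄ cstar : ℝ), α₁ = 198 * (((ρ' : ℝ) + M' + 1) * ε₀) + 27 * (((ρ' : ℝ) + M' + 1) * ε₀) / ((L : ℝ) * B₀) →
      cstar = 5 * (F.P K).d * (F.P K).L * B₀ * (ε₀ + α₁) →
      α₄ = 8 * (300 * (L : ℝ) * ((3 * (M' + ρ') + 1 : ℕ) : ℝ) * (B₀'H + 15 * (L : ℝ) ^ 2 * BG * BR + 3 * BG * BR * B₂')) * (5 * ((3 : ℕ) : ℝ) * L * B₀) * (ε₀ + α₁) →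
      ∀ (s : ℝ), s = (198 + 12 * (((M' : ℝ) - 1) + 4 * ρ')) * ε₀ →
      ∀ (gJ : GaugeTransf (F.P K) 0 (Matrix.specialUnitaryGroup (Fin 2) ℂ)),
      InAk (F.P K).L (K - n) (((F.L : ℝ)⁻¹) ^ (K - n)) ε₀ (fun _ => (Set.univ : Set (LSite (F.P K).d))) (pull (unitsField (toUField (GaugeField.gaugeAct gJ U))) 0) →
      (∀ m', m' ≤ K - n → ∀ Λ : ℕ → Set (LSite (F.P K).d), InAx (F.P K).L m' Λ (1 : LSite (F.P K).d → Fin (F.P K).d → (Matrix (Fin 2) (Fin 2) ℂ)ˣ) (pull (unitsField (toUField (GaugeField.gaugeAct gJ U))) 0)) →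
      (∀ m', m' ≤ K - n → ∀ (x : LSite (F.P K).d) (ν : Fin (F.P K).d), tlo (F.P K).L (tLo a ρ') m' ≤ x → x + e ν ≤ thi (F.P K).L (tHi a M' ρ') m' →
      ‖((avgIter (F.P K).L (pull (unitsField (toUField (GaugeField.gaugeAct gJ U))) 0) (K - n - m') x ν : (Matrix (Fin 2) (Fin 2) ℂ)ˣ) :
      Matrix (Fin 2) (Fin 2) ℂ) - 1‖ < s) →
      ∀ (g' : GaugeTransf (F.P K) 0 (Matrix (Fin 2) (Fin 2) ℂ)ˣ) (u : LSite (F.P K).d → (Matrix (Fin 2) (Fin 2) ℂ)ˣ) (V' : LSite (F.P K).d → Fin (F.P K).d → (Matrix (Fin 2) (Fin 2) ℂ)ˣ)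
      (A' : LSite (F.P K).d → Fin (F.P K).d → (Matrix (Fin 2) (Fin 2) ℂ)),
      (∀ x, u x ∈ unitaryUnits (Matrix (Fin 2) (Fin 2) ℂ)) → mgauge (1 : LSite (F.P K).d → Fin (F.P K).d → (Matrix (Fin 2) (Fin 2) ℂ)ˣ) u V' = (pull (unitsField (toUField (GaugeField.gaugeAct gJ U))) 0) →
      Restr129 (F.P K).L (K - n) (Function.update (cubeLamS (F.P K).L a M' ρ' (K - n) (K - n)) (K - n) ∅) (1 : LSite (F.P K).d → Fin (F.P K).d → (Matrix (Fin 2) (Fin 2) ℂ)ˣ) u →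
      (IsLandau138W (F.P K).L (K - n) (((F.L : ℝ)⁻¹) ^ (K - n)) ((cubeFam false (F.P K).L a M' ρ' (K - n)) 0) (cubeLamS (F.P K).L a M' ρ' (K - n) (K - n)) (1 : LSite (F.P K).d → Fin (F.P K).d → (Matrix (Fin 2) (Fin 2) ℂ)ˣ) V' ∧
      (∀ c ∈ (cubeLamB (F.P K).L a M' ρ' (K - n) (K - n)) (K - n), ∀ (y : LSite (F.P K).d) (τ : Fin (F.P K).d),
      InBox (loK (F.P K).L (K - n) c.1) (bondHiK (F.P K).L (K - n) c.1 c.2) y → InBox (loK (F.P K).L (K - n) c.1) (bondHiK (F.P K).L (K - n) c.1 c.2) (y + e τ) →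
      V' y τ = gaugeActT g' (unitsField (toUField U)) ⟨cover (F.P K) y, τ⟩)) →
      (∀ y τ, IsSelfAdjoint (A' y τ)) →
      (∀ j, j ≤ K - n → ∀ y τ, SideTouches ((cubeFam false (F.P K).L a M' ρ' (K - n)) j) y τ →
      V' y τ = cfgExp (((F.L : ℝ)⁻¹) ^ (K - n)) A' y τ ∧ ‖A' y τ‖ ≤ (2 * ((F.P K).L * cstar) + 8 * α₄) * (((F.P K).L : ℝ) ^ j * (((F.L : ℝ)⁻¹) ^ (K - n)))⁻¹) →
      (∀ y τ, (∀ j, j ≤ K - n → ¬ SideTouches ((cubeFam false (F.P K).L a M' ρ' (K - n)) j) y τ) → A' y τ = 0) →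
      msup (F.P K).L (K - n) (((F.L : ℝ)⁻¹) ^ (K - n)) (-(1 : ℝ)) (fun j (b : LSite (F.P K).d × Fin (F.P K).d) => SideTouches ((cubeFam false (F.P K).L a M' ρ' (K - n)) j) b.1 b.2) (fun b => A' b.1 b.2)
      ≤ B₀ * (bondNorm (F.P K).L (K - n) (((F.L : ℝ)⁻¹) ^ (K - n)) (-(3 : ℝ)) (cubeFam false (F.P K).L a M' ρ' (K - n)) (fun x μ => Jcur (((F.L : ℝ)⁻¹) ^ (K - n)) (1 : LSite (F.P K).d → Fin (F.P K).d → (Matrix (Fin 2) (Fin 2) ℂ)ˣ) A' μ x)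
      + wsup 1 (fun p : {p : ℕ × (LSite (F.P K).d × Fin (F.P K).d) // p.1 ≤ K - n ∧ p.2 ∈ (cubeLamB (F.P K).L a M' ρ' (K - n) (K - n)) p.1} =>
      linCovIter (F.P K).L (1 : LSite (F.P K).d → Fin (F.P K).d → (Matrix (Fin 2) (Fin 2) ℂ)ˣ) (iEta (((F.L : ℝ)⁻¹) ^ (K - n)) A') p.1.1 p.1.2.1 p.1.2.2)) ∧
      msup (F.P K).L (K - n) (((F.L : ℝ)⁻¹) ^ (K - n)) (-(2 : ℝ)) (fun j (t : Fin (F.P K).d × Fin (F.P K).d × LSite (F.P K).d) => SideTouches ((cubeFam false (F.P K).L a M' ρ' (K - n)) j) t.2.2 t.2.1)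
      (fun t => covDerivFwd (((F.L : ℝ)⁻¹) ^ (K - n)) (1 : LSite (F.P K).d → Fin (F.P K).d → (Matrix (Fin 2) (Fin 2) ℂ)ˣ) t.1 (fun z => A' z t.2.1) t.2.2)
      ≤ B₀ * (bondNorm (F.P K).L (K - n) (((F.L : ℝ)⁻¹) ^ (K - n)) (-(3 : ℝ)) (cubeFam false (F.P K).L a M' ρ' (K - n)) (fun x μ => Jcur (((F.L : ℝ)⁻¹) ^ (K - n)) (1 : LSite (F.P K).d → Fin (F.P K).d → (Matrix (Fin 2) (Fin 2) ℂ)ˣ) A' μ x)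
      + wsup 1 (fun p : {p : ℕ × (LSite (F.P K).d × Fin (F.P K).d) // p.1 ≤ K - n ∧ p.2 ∈ (cubeLamB (F.P K).L a M' ρ' (K - n) (K - n)) p.1} =>
      linCovIter (F.P K).L (1 : LSite (F.P K).d → Fin (F.P K).d → (Matrix (Fin 2) (Fin 2) ℂ)ˣ) (iEta (((F.L : ℝ)⁻¹) ^ (K - n)) A') p.1.1 p.1.2.1 p.1.2.2))) := by
  classical
  letI : CStarAlgebra (Matrix (Fin 2) (Fin 2) ℂ) := B10Eq29TubeLine.cstarAlgebraMatrix 2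
  intro F hF n K hnK ρ S M ρ' hρ'def hM hS a₅ Cr ε₀ ε₁ hCr hCr4 h12 hε₁ hε₀ hε₀a hCrε hw hroom V hV U hU x₀ t ht0 ht a hadef α₁ α₄ cstar
    hα₁def hcdef hα₄def s hsdef gJ hInAk hInAx htw g' u V' A' hu hW h129 hLan hsa h41 h0
  -- letters of the member
  have hd3 : (F.P K).d = 3 := T3Family.P_d F K
  have hLF : (F.P K).L = F.L := rfl
  have hL2P : 2 ≤ (F.P K).L := by rw [hLF, hF]; omega
  have hL1P : 1 ≤ (F.P K).L := le_trans (by norm_num) hL2P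
  have hLr : ((F.P K).L : ℝ) = (L : ℝ) := by rw [hLF, hF]
  have hη : 0 < ((F.L : ℝ)⁻¹) ^ (K - n) := by
    have hL0 : (0 : ℝ) < F.L := by exact_mod_cast (F.P K).L_pos
    positivity
  -- the window tuple from the member's own smallness (✓p655819), and the `cB9` window (file 1∕3)
  have hw' := hw
  rw [← hLr] at hw'
  subst hρ'def
  obtain ⟨m₀, α₀, α₁', a₆₆, cstar', B₀', α₄', C₂, cB, cA, cDA, c', σ, δ, ω, Cb, Cl, τ₀, e0, eα₀, ea, e1, ec, eB, e4, eC, ecB, ecA, ecDA, ecp, eσ, eδ, eω, eτ₀,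
    -, -, ⟨hα₀9, -⟩, -, -⟩ :=
    exists_topCall_constants_of_rhoWindow₃ (F.P K).d (F.P K).L hd3 hL2P hB₀ hB₀'H hB₂' hBG hBR hcB9 M' (ρ + M + L + S) hε₀ hw'
  obtain ⟨hα₂0, hα₂9, -⟩ := alpha2_le_cB9_of_hw (F.P K).d (F.P K).L hd3 hL2P hB₀ hB₀'H hB₂' hBG hBR hcB9 M' (ρ + M + L + S) hε₀ hw' e0 eα₀ e1 ec eB e4
  -- identify the closure's letters with the bridge's
  have hα₁E : α₁ = α₁' := by rw [hα₁def, e1, hLr]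
  have hcE : cstar = cstar' := by rw [hcdef, ec, eα₀, hα₁E]
  have hα₄E : α₄ = α₄' := by rw [hα₄def, e4, eB, e0, eα₀, hα₁E, hd3, hLr]
  rw [← hcE, ← hα₄E] at hα₂0 hα₂9
  rw [eα₀] at hα₀9
  -- the (1.59)-family socket at the top level `m := K − n`
  obtain ⟨len, hS⟩ := hSB9All F n K hnK a (ρ + M + L + S) (K - n) le_rfl
  -- the guards: `1` and `V′` unitary, (1.40) for `1` and for `V′·1`, Landau
  have h1u : ∀ (x : LSite (F.P K).d) (κ : Fin (F.P K).d), (1 : LSite (F.P K).d → Fin (F.P K).d → (Matrix (Fin 2) (Fin 2) ℂ)ˣ) x κ ∈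
      unitaryUnits (Matrix (Fin 2) (Fin 2) ℂ) := fun _ _ => (unitaryUnits _).one_mem
  have hU'u : ∀ (x : LSite (F.P K).d) (κ : Fin (F.P K).d),
      pull (unitsField (toUField (GaugeField.gaugeAct gJ U))) 0 x κ ∈ unitaryUnits (Matrix (Fin 2) (Fin 2) ℂ) :=
    fun x κ => by rw [pull_apply]; exact unitsField_mem_unitaryUnits _ _
  have hV'u : ∀ (x : LSite (F.P K).d) (κ : Fin (F.P K).d), V' x κ ∈ unitaryUnits (Matrix (Fin 2) (Fin 2) ℂ) :=
    mem_unitaryUnits_of_mgauge_eq h1u hU'u hu hW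
  have h33 : InAk (F.P K).L (K - n) (((F.L : ℝ)⁻¹) ^ (K - n)) ε₀ (cubeFam false (F.P K).L a M' (ρ + M + L + S) (K - n))
      (1 : LSite (F.P K).d → Fin (F.P K).d → (Matrix (Fin 2) (Fin 2) ℂ)ˣ) := one_inAk hL1P (K - n) hη hε₀ _
  have h34 := h34_of_inAk_univ hInAk (cubeFam false (F.P K).L a M' (ρ + M + L + S) (K - n))
  have h40 : InAk (F.P K).L (K - n) (((F.L : ℝ)⁻¹) ^ (K - n)) ε₀ (cubeFam false (F.P K).L a M' (ρ + M + L + S) (K - n))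
      (mulCfg V' (1 : LSite (F.P K).d → Fin (F.P K).d → (Matrix (Fin 2) (Fin 2) ℂ)ˣ)) := by
    have hui : ∀ x, u⁻¹ x ∈ B7Prop1Explicit.U1 (Matrix (Fin 2) (Fin 2) ℂ) := fun x => unitaryUnits_le_U1 ((unitaryUnits _).inv_mem (hu x))
    rw [mulCfg_eq_gaugeAct_of_mgauge_eq hW]
    exact (inAk_gaugeAct_iff (F.P K).L (K - n) _ ε₀ _ hui _).2 h34
  have h := hS ε₀ (2 * ((F.P K).L * cstar) + 8 * α₄) hε₀ hα₀9 hα₂0 hα₂9 _ V' h1u hV'u h33 h40 hLan.1 A' hsa h41 h0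
  exact ⟨h.1, h.2.1⟩

end Summit.QuantumFields.YangMills.Theorems.HalvingH59TLOfSockB9All

end
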